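import Summits.Ventures.PackingBounds.Energy.GramListQuad
import HarnessLib

/-!
# List-structural quadratic forms over an explicit LIST of vector entries (`quadL`), and block splitting

Framing: lottery ticket; floor = certified bounds/negative ranges. Venture `PackingBounds`, cell
`pub-packcert`, energy family E3PT (pub-packcert-energy gen 15; KERNEL-D6 double data route at SDP degree 8).

`GramData.listQuad y X i0` (module `GramListQuad`) unfolds structurally in the integer table `X` but addresses the
vector through a FUNCTION `y : ℕ → ℝ`, so a `simp` bridge must rewrite every `y k` (for the monomial vector of a
degree-8 certificate: a 165-arm `match`, measured at ≈ 0.1 s per rewrite — too slow for 165 × 165 tables).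
`quadL ms X rest` takes the vector as an explicit LIST `ms` (and the suffix `rest` of row entries), so the whole
form unfolds by plain pattern matching with no index arithmetic and no per-entry lookups:
`quadL ms (row :: rows) (m :: rest) = rowDot m row ms + quadL ms rows rest`, `rowDot c (x :: xs) (m :: ms') = x·c·m + …`.
`quadL_eq_listQuad` identifies the two (for `y k = ms.getD k 0`), `quadL_append` splits a table into row blocks
(one gate-sized file per block), `drop_eq_getD_cons` is the list lemma used for both.
-/

namespace Summit.Ventures.PackingBounds.Energy.GramData

open Finset

/-- `Σ_k (row[k] : ℝ) · c · ms[k]`, structurally in both lists (extra entries of either list are ignored). -/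
def rowDot (c : ℝ) : List ℤ → List ℝ → ℝ
  | [], _ => 0
  | _ :: _, [] => 0
  | x :: xs, m :: ms => (x : ℝ) * c * m + rowDot c xs ms

/-- `Σ_a rest[a] · rowDot (rows[a]) ms`: the quadratic form `Σ_{a,b} rows[a][b] · rest[a] · ms[b]`, structurally. -/
def quadL (ms : List ℝ) : List (List ℤ) → List ℝ → ℝ
  | [], _ => 0
  | _ :: _, [] => 0
  | row :: rows, m :: rest => rowDot m row ms + quadL ms rows rest

/-- `quadL` over an exhausted entry list vanishes. -/
@[simp] theorem quadL_nil_right (ms : List ℝ) : ∀ (B : List (List ℤ)), quadL ms B [] = 0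
  | [] => rfl
  | _ :: _ => rfl

/-- `ms.drop i = ms[i] :: ms.drop (i+1)` for `i < ms.length` (with `getD`). -/
theorem drop_eq_getD_cons : ∀ (ms : List ℝ) (i : ℕ), i < ms.length → ms.drop i = ms.getD i 0 :: ms.drop (i + 1)
  | [], i, h => absurd h (by simp)
  | m :: ms, 0, _ => by simp
  | m :: ms, i + 1, h => by
    simp only [List.drop_succ_cons, List.getD_cons_succ]
    exact drop_eq_getD_cons ms i (by simpa using h)

/-- `rowDot (y i) row ms = rowQuad y i row j0` when `ms` lists the values `y (j0 + k)`. -/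
theorem rowDot_eq (y : ℕ → ℝ) (i : ℕ) :
    ∀ (row : List ℤ) (j0 : ℕ) (ms : List ℝ), row.length ≤ ms.length →
      (∀ k, k < row.length → ms.getD k 0 = y (j0 + k)) → rowDot (y i) row ms = rowQuad y i row j0
  | [], j0, ms, _, _ => by simp [rowDot, rowQuad]
  | x :: xs, j0, [], h, _ => absurd h (by simp)
  | x :: xs, j0, m :: ms, h, hk => by
    rw [rowDot, rowQuad]
    have hm : m = y j0 := by
      have h0 := hk 0 (by simp)
      simpa using h0
    have ih := rowDot_eq y i xs (j0 + 1) ms (by simpa using h) (fun k hk' => by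
      have h1 := hk (k + 1) (by simpa using hk')
      rw [List.getD_cons_succ] at h1
      rw [h1, show j0 + (k + 1) = j0 + 1 + k by omega])
    rw [hm, ih]

/-- **`quadL` is `listQuad`:** if `ms` lists the values of `y` (`ms.getD k 0 = y k`), every row of `rows` has
length `≤ ms.length` and `rows.length + i0 ≤ ms.length`, then `quadL ms rows (ms.drop i0) = listQuad y rows i0`. -/
theorem quadL_eq_listQuad (y : ℕ → ℝ) (ms : List ℝ) (hms : ∀ k, k < ms.length → ms.getD k 0 = y k) :
    ∀ (rows : List (List ℤ)) (i0 : ℕ), (∀ row ∈ rows, row.length ≤ ms.length) →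
      rows.length + i0 ≤ ms.length → quadL ms rows (ms.drop i0) = listQuad y rows i0
  | [], i0, _, _ => by simp [quadL, listQuad]
  | row :: rows, i0, hrow, hlen => by
    have hi0 : i0 < ms.length := by
      simp only [List.length_cons] at hlen; omega
    rw [drop_eq_getD_cons ms i0 hi0, quadL, listQuad, hms i0 hi0,
      rowDot_eq y i0 row 0 ms (hrow row (by simp)) (fun k hk => by
        rw [Nat.zero_add]; exact hms k (lt_of_lt_of_le hk (hrow row (by simp)))),
      quadL_eq_listQuad y ms hms rows (i0 + 1) (fun r hr => hrow r (by simp [hr])) (by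
        simp only [List.length_cons] at hlen; omega)]

/-- The same at offset `0`: `quadL ms rows ms = listQuad y rows 0`. -/
theorem quadL_eq_listQuad_zero (y : ℕ → ℝ) (ms : List ℝ) (hms : ∀ k, k < ms.length → ms.getD k 0 = y k)
    (rows : List (List ℤ)) (hrow : ∀ row ∈ rows, row.length ≤ ms.length) (hlen : rows.length ≤ ms.length) :
    quadL ms rows ms = listQuad y rows 0 := by
  have h := quadL_eq_listQuad y ms hms rows 0 hrow (by simpa using hlen)
  simpa using h

/-- **Row-block splitting:** `quadL ms (A ++ B) rest = quadL ms A rest + quadL ms B (rest.drop A.length)`. -/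
theorem quadL_append (ms : List ℝ) :
    ∀ (A B : List (List ℤ)) (rest : List ℝ), quadL ms (A ++ B) rest = quadL ms A rest + quadL ms B (rest.drop A.length)
  | [], B, rest => by simp [quadL]
  | row :: A, B, [] => by simp [quadL]
  | row :: A, B, m :: rest => by
    rw [List.cons_append, quadL, quadL, quadL_append ms A B rest, List.length_cons, List.drop_succ_cons, add_assoc]

end Summit.Ventures.PackingBounds.Energy.GramData
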